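import Summits.Ventures.PercRepro.S1FiveCircuitX2

/-!
# PercRepro — LEMMA X⁺, part 2: the excluded points, counted (p2, gen 18)

Every triangle `T`, point `e ∈ T` and `2`-set `R ⊆ E ∖ T` gives the `4`-set `Q = (T ∖ e) ∪ R` with `e ∈ excl(Q)`, and a
pair `(Q, e)` arises from at most two such triples (two triangles through `e` with their other points in the `4`-set
`Q` have disjoint pairs there, by (C1)): `3·s₃·C(n−3, 2) ≤ 2·Σ_Q #excl(Q)`.

* `three_mul_card_mul_choose_le_two_mul_sum_card_excl` — `3·s₃·C(n−3,2) ≤ 2·Σ_Q #excl(Q)` (under (C1)).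
Axioms: standard.
-/

open scoped Matroid

namespace PercRepro

namespace S1

open Set

variable {α : Type}

open Classical in
/-- **The excluded points, counted**: `3·s₃·C(n−3, 2) ≤ 2·Σ_Q #excl(Q)` (under (C1)). Every triangle `T`, point
`e ∈ T` and `2`-set `R ⊆ E ∖ T` gives the `4`-set `Q = (T ∖ e) ∪ R` with `e ∈ excl(Q)`; a pair `(Q, e)` arises from
at most two such triples. -/
theorem three_mul_card_mul_choose_le_two_mul_sum_card_excl (M : Matroid α) [M.Finite]
    (hC1 : ∀ L ⊆ M.E, M.eRk L = 2 → L.ncard ≤ 3) :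
    3 * (finite_triangles M).toFinset.card * (M.E.ncard - 3).choose 2 ≤
      2 * ∑ Q ∈ M.ground_finite.toFinset.powersetCard 4, (excl M Q).card := by
  classical
  set Ef := M.ground_finite.toFinset with hEf
  have hmemE : ∀ x, x ∈ Ef ↔ x ∈ M.E := fun x => Set.Finite.mem_toFinset _
  have hEcard : Ef.card = M.E.ncard := (Set.ncard_eq_toFinset_card _ _).symm
  set F3 := (finite_triangles M).toFinset with hF3
  -- the finset of points of `T`
  set Tf : Set α → Finset α := fun T => Ef.filter (fun x => x ∈ T) with hTf
  have hTfcoe : ∀ T ∈ F3, ((Tf T : Finset α) : Set α) = T := by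
    intro T hT
    rw [hF3, Set.Finite.mem_toFinset] at hT
    ext x
    simp only [hTf, Finset.coe_filter, Set.mem_setOf_eq, hmemE]
    exact ⟨fun h => h.2, fun h => ⟨hT.1.subset_ground h, h⟩⟩
  have hTfcard : ∀ T ∈ F3, (Tf T).card = 3 := by
    intro T hT
    have h := hTfcoe T hT
    rw [hF3, Set.Finite.mem_toFinset] at hT
    rw [← Set.ncard_coe_finset, h, hT.2]
  have hTfsub : ∀ T, Tf T ⊆ Ef := fun T => Finset.filter_subset _ _
  -- the domain: triples `(T, e, R)`
  set Dom : Finset (Σ _ : Set α, α × Finset α) :=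
    F3.sigma (fun T => (Tf T) ×ˢ (Ef \ Tf T).powersetCard 2) with hDom
  have hDomterm : ∀ T ∈ F3, ((Tf T) ×ˢ (Ef \ Tf T).powersetCard 2).card = 3 * (M.E.ncard - 3).choose 2 := by
    intro T hT
    rw [Finset.card_product, Finset.card_powersetCard, hTfcard T hT]
    have h := Finset.card_sdiff_add_card_eq_card (hTfsub T)
    rw [hTfcard T hT, hEcard] at h
    have : (Ef \ Tf T).card = M.E.ncard - 3 := by omega
    rw [this]
  have hDomcard : Dom.card = F3.card * (3 * (M.E.ncard - 3).choose 2) := by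
    rw [hDom, Finset.card_sigma, Finset.sum_congr rfl hDomterm, Finset.sum_const, smul_eq_mul]
  -- the map `(T, e, R) ↦ (Q, e)` with `Q = (T ∖ e) ∪ R`
  let f : (Σ _ : Set α, α × Finset α) → (Σ _ : Finset α, α) :=
    fun x => ⟨(Tf x.1).erase x.2.1 ∪ x.2.2, x.2.1⟩
  set Pairs : Finset (Σ _ : Finset α, α) := (Ef.powersetCard 4).sigma (fun Q => excl M Q) with hPairs
  have hPairscard : Pairs.card = ∑ Q ∈ Ef.powersetCard 4, (excl M Q).card := Finset.card_sigma _ _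
  -- membership facts of the domain
  have hDommem : ∀ x ∈ Dom, x.1 ∈ ThmN.triangles M ∧ x.2.1 ∈ M.E ∧ x.2.1 ∈ x.1 ∧
      x.2.2 ⊆ Ef \ Tf x.1 ∧ x.2.2.card = 2 := by
    intro x hx
    rw [hDom, Finset.mem_sigma, Finset.mem_product, Finset.mem_powersetCard] at hx
    obtain ⟨hT, he, hR, hR2⟩ := hx
    rw [hF3, Set.Finite.mem_toFinset] at hT
    simp only [hTf, Finset.mem_filter, hmemE] at he
    exact ⟨hT, he.1, he.2, hR, hR2⟩
  -- the image lies in `Pairs`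
  have himage : Dom.image f ⊆ Pairs := by
    intro b hb
    rw [Finset.mem_image] at hb
    obtain ⟨x, hx, rfl⟩ := hb
    obtain ⟨hT, heE, heT, hR, hR2⟩ := hDommem x hx
    have hTF : x.1 ∈ F3 := by rw [hF3, Set.Finite.mem_toFinset]; exact hT
    have heTf : x.2.1 ∈ Tf x.1 := by
      simp only [hTf, Finset.mem_filter, hmemE]
      exact ⟨heE, heT⟩
    have hdisj : Disjoint ((Tf x.1).erase x.2.1) x.2.2 := by
      rw [Finset.disjoint_left]
      intro z hz hz'
      have hz2 := hR hz'
      rw [Finset.mem_sdiff] at hz2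
      exact hz2.2 (Finset.mem_of_mem_erase hz)
    have hQcard : ((Tf x.1).erase x.2.1 ∪ x.2.2).card = 4 := by
      rw [Finset.card_union_eq_card_add_card.2 hdisj, Finset.card_erase_of_mem heTf, hTfcard _ hTF, hR2]
    have hQE : (Tf x.1).erase x.2.1 ∪ x.2.2 ⊆ Ef :=
      Finset.union_subset ((Finset.erase_subset _ _).trans (hTfsub _)) (hR.trans Finset.sdiff_subset)
    rw [hPairs, Finset.mem_sigma, Finset.mem_powersetCard, mem_excl]
    refine ⟨⟨hQE, hQcard⟩, heE, ?_, x.1, hT, heT, ?_⟩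
    · intro hmem
      rw [Finset.mem_union] at hmem
      rcases hmem with h | h
      · exact (Finset.notMem_erase _ _) h
      · have := hR h
        rw [Finset.mem_sdiff] at this
        exact this.2 heTf
    · intro z hz
      obtain ⟨hzT, hze⟩ := hz
      have hze' : z ≠ x.2.1 := fun h => hze (h ▸ Set.mem_singleton _)
      rw [Finset.coe_union, Finset.coe_erase, hTfcoe _ hTF]
      exact Set.mem_union_left _ ⟨hzT, hze'⟩
  -- the fibres have at most two elements
  have hfib : ∀ b ∈ Dom.image f, (Dom.filter (fun x => f x = b)).card ≤ 2 := by
    intro b _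
    obtain ⟨Q, e⟩ := b
    -- the fibre injects into the triangles through `e` with their other points in `Q`
    have hQ4 : Q.card = 4 ∨ (Dom.filter (fun x => f x = ⟨Q, e⟩)).card = 0 := by
      by_cases hne : (Dom.filter (fun x => f x = ⟨Q, e⟩)).Nonempty
      · obtain ⟨x, hx⟩ := hne
        rw [Finset.mem_filter] at hx
        obtain ⟨hxD, hfx⟩ := hx
        obtain ⟨hT, heE, heT, hR, hR2⟩ := hDommem x hxD
        have hTF : x.1 ∈ F3 := by rw [hF3, Set.Finite.mem_toFinset]; exact hT
        have heTf : x.2.1 ∈ Tf x.1 := by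
          simp only [hTf, Finset.mem_filter, hmemE]
          exact ⟨heE, heT⟩
        have hdisj : Disjoint ((Tf x.1).erase x.2.1) x.2.2 := by
          rw [Finset.disjoint_left]
          intro z hz hz'
          have hz2 := hR hz'
          rw [Finset.mem_sdiff] at hz2
          exact hz2.2 (Finset.mem_of_mem_erase hz)
        have hQcard : ((Tf x.1).erase x.2.1 ∪ x.2.2).card = 4 := by
          rw [Finset.card_union_eq_card_add_card.2 hdisj, Finset.card_erase_of_mem heTf, hTfcard _ hTF, hR2]
        left
        have := congrArg Sigma.fst hfx
        simp only [f] at this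
        rw [← this]
        exact hQcard
      · right
        rw [Finset.not_nonempty_iff_eq_empty] at hne
        rw [hne, Finset.card_empty]
    rcases hQ4 with hQ4 | h0
    · refine (Finset.card_le_card_of_injOn (fun x => x.1) ?_ ?_).trans
        (card_filter_triangles_through_subset_le_two M hC1 hQ4 e)
      · intro x hx
        rw [Finset.mem_coe, Finset.mem_filter] at hx
        obtain ⟨hxD, hfx⟩ := hx
        obtain ⟨hT, heE, heT, hR, hR2⟩ := hDommem x hxD
        have h1 := congrArg Sigma.fst hfx
        have h2 := congrArg Sigma.snd hfx
        simp only [f] at h1 h2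
        simp only [Finset.mem_coe, Finset.mem_filter, Set.Finite.mem_toFinset]
        refine ⟨hT, ?_, ?_⟩
        · rw [← h2]; exact heT
        · intro z hz
          obtain ⟨hzT, hze⟩ := hz
          rw [← h1]
          have hTF : x.1 ∈ F3 := by rw [hF3, Set.Finite.mem_toFinset]; exact hT
          rw [Finset.coe_union, Finset.coe_erase, hTfcoe _ hTF]
          refine Set.mem_union_left _ ⟨hzT, fun h => hze ?_⟩
          rw [Set.mem_singleton_iff] at h ⊢
          rw [h, h2]
      · intro x hx y hy hxy
        rw [Finset.mem_coe, Finset.mem_filter] at hx hy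
        obtain ⟨hxD, hfx⟩ := hx
        obtain ⟨hyD, hfy⟩ := hy
        obtain ⟨hTx, -, -, hRx, -⟩ := hDommem x hxD
        obtain ⟨hTy, -, -, hRy, -⟩ := hDommem y hyD
        have hx1 := congrArg Sigma.fst hfx
        have hx2 := congrArg Sigma.snd hfx
        have hy1 := congrArg Sigma.fst hfy
        have hy2 := congrArg Sigma.snd hfy
        simp only [f] at hx1 hx2 hy1 hy2
        simp only at hxy
        -- `x.2.2 = Q \ (Tf x.1).erase e = y.2.2`
        have hRx' : x.2.2 = Q \ (Tf x.1).erase x.2.1 := by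
          rw [← hx1]
          ext z
          rw [Finset.mem_sdiff, Finset.mem_union]
          constructor
          · intro hz
            refine ⟨Or.inr hz, fun hz' => ?_⟩
            have := hRx hz
            rw [Finset.mem_sdiff] at this
            exact this.2 (Finset.mem_of_mem_erase hz')
          · rintro ⟨hz | hz, hz'⟩
            · exact (hz' hz).elim
            · exact hz
        have hRy' : y.2.2 = Q \ (Tf y.1).erase y.2.1 := by
          rw [← hy1]
          ext z
          rw [Finset.mem_sdiff, Finset.mem_union]
          constructor
          · intro hz
            refine ⟨Or.inr hz, fun hz' => ?_⟩
            have := hRy hz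
            rw [Finset.mem_sdiff] at this
            exact this.2 (Finset.mem_of_mem_erase hz')
          · rintro ⟨hz | hz, hz'⟩
            · exact (hz' hz).elim
            · exact hz
        obtain ⟨Tx, ex, Rx⟩ := x
        obtain ⟨Ty, ey, Ry⟩ := y
        simp only at hxy hx2 hy2 hRx' hRy'
        subst hxy
        have hee : ex = ey := by rw [hx2, hy2]
        subst hee
        rw [hRx', hRy']
    · rw [h0]
      exact Nat.zero_le _
  have hle := Finset.card_le_mul_card_image Dom 2 hfib
  calc 3 * F3.card * (M.E.ncard - 3).choose 2 = Dom.card := by rw [hDomcard]; ring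
    _ ≤ 2 * (Dom.image f).card := hle
    _ ≤ 2 * Pairs.card := Nat.mul_le_mul_left _ (Finset.card_le_card himage)
    _ = 2 * ∑ Q ∈ Ef.powersetCard 4, (excl M Q).card := by rw [hPairscard]

end S1

end PercRepro
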